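import Summits.Ventures.HodgeRepro2.T5CyclotomicStaysPrimeIffEven

/-!
# FOR EVERY CM FIELD: a place `v` of `K⁺` has ONE prime of `K` above it iff complex conjugation fixes that prime —
# «`v` non-split ⟺ `c ∈ D(w/v)`», the Galois end of the dictionary of §N2.2.5

Tier-5 support N2 / N3 (seat p3, gen 79). File 272 proved, for `K = ℚ(ζ_ℓ)`, that the primes of `K` above a place
`v` of `K⁺` are `P` and `c • P` (`Gal(K/K⁺) = {1, c}` acts transitively), so that `v` has one prime above it iff `c`
fixes `P`. Nothing in that argument used the cyclotomic structure: this file states it for EVERY CM field `K` (Mathlib's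
`IsCMField`), closing the Galois end of the dictionary «`v` non-split in `K` ⟺ `c ∈ D_w` ⟺ `[K_w : K⁺_v] = 2` ⟺
`θ ∉ (K⁺_v)^{×2}`» (files 120–125 gave the local ends):

* `smul_mem_primesOver`, `eq_one_or_eq_complexConj`, **`primesOver_eq_pair`** — the primes above `v` are `{P, c • P}`;
* **`ncard_primesOver_eq_one_iff_smul_eq`**, `ncard_primesOver_eq_two_iff_smul_ne` — one prime above `v` iff
  `c • P = P`, two iff `c • P ≠ P`;
* **`complexConj_mem_stabilizer_iff_ncard_eq_one`** — `c` lies in the decomposition group `D(P/v) = Stab(P)` iff `v`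
  has one prime above it; **`exists_map_eq_iff_smul_eq`** — for an unramified `P`, `v` stays prime (`v 𝓞_K = P`) iff
  `c • P = P`.

§8(d): uses an L-value-free non-vanishing device: NO.
-/

open NumberField NumberField.IsCMField IsDedekindDomain IsDedekindDomain.HeightOneSpectrum Module MulAction
open scoped Pointwise
open Summit.Ventures.HodgeRepro2.T5RecordSatakeInert Summit.Ventures.HodgeRepro2.T5FinitePlaceSplitIff
  Summit.Ventures.HodgeRepro2.T5FinitePlaceLocalDegree Summit.Ventures.HodgeRepro2.T5RecordSatakeIntrinsic
  Summit.Ventures.HodgeRepro2.T5CyclotomicSevenHeckeCommutative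

namespace Summit.Ventures.HodgeRepro2.T5CMFieldConjugationDecomposition

section CM

variable (K : Type*) [Field K] [NumberField K] [IsCMField K]
variable (v : HeightOneSpectrum (𝓞 (maximalRealSubfield K))) (P : Ideal (𝓞 K)) [hP : P.IsPrime]
  [hPv : P.LiesOver v.asIdeal]

/-- The image of a prime above `v` under an element of `Gal(K/K⁺)` is a prime above `v`. -/
theorem smul_mem_primesOver (σ : K ≃ₐ[maximalRealSubfield K] K) : σ • P ∈ v.asIdeal.primesOver (𝓞 K) :=
  ⟨Ideal.IsPrime.smul σ, Ideal.LiesOver.smul σ⟩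

omit hP hPv in
/-- Every element of `Gal(K/K⁺)` is `1` or complex conjugation (Mathlib's `zpowers_complexConj_eq_top`,
`orderOf_complexConj`). -/
theorem eq_one_or_eq_complexConj (σ : K ≃ₐ[maximalRealSubfield K] K) :
    σ = 1 ∨ σ = complexConj K := by
  classical
  have hmem : σ ∈ Subgroup.zpowers (complexConj K) := by
    rw [zpowers_complexConj_eq_top]
    exact Subgroup.mem_top σ
  rw [mem_zpowers_iff_mem_range_orderOf, orderOf_complexConj] at hmem
  obtain ⟨k, hk, rfl⟩ := Finset.mem_image.mp hmem
  rw [Finset.mem_range] at hk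
  interval_cases k
  · exact Or.inl (pow_zero _)
  · exact Or.inr (pow_one _)

/-- **The primes of `K` above `v` are `P` and `c • P`** (`Gal(K/K⁺) = {1, c}` acts transitively). -/
theorem primesOver_eq_pair : v.asIdeal.primesOver (𝓞 K) = {P, complexConj K • P} := by
  ext Q
  constructor
  · intro hQ
    haveI := hQ.1
    haveI := hQ.2
    obtain ⟨σ, hσ⟩ := Ideal.exists_smul_eq_of_isGaloisGroup v.asIdeal P Q (K ≃ₐ[maximalRealSubfield K] K)
    rcases eq_one_or_eq_complexConj K σ with h | h
    · rw [h, one_smul] at hσ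
      exact Or.inl hσ.symm
    · rw [h] at hσ
      exact Or.inr hσ.symm
  · rintro (rfl | rfl)
    · exact ⟨hP, hPv⟩
    · exact smul_mem_primesOver K v P (complexConj K)

/-- **One prime above `v` iff complex conjugation fixes `P`.** -/
theorem ncard_primesOver_eq_one_iff_smul_eq :
    (v.asIdeal.primesOver (𝓞 K)).ncard = 1 ↔ complexConj K • P = P := by
  rw [primesOver_eq_pair K v P]
  constructor
  · intro h1
    by_contra hne
    rw [Set.ncard_pair (Ne.symm hne)] at h1
    exact absurd h1 (by norm_num)
  · intro h
    rw [h, Set.pair_eq_singleton, Set.ncard_singleton]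

/-- **Two primes above `v` iff complex conjugation moves `P`.** -/
theorem ncard_primesOver_eq_two_iff_smul_ne :
    (v.asIdeal.primesOver (𝓞 K)).ncard = 2 ↔ complexConj K • P ≠ P := by
  rw [primesOver_eq_pair K v P]
  constructor
  · intro h2 h
    rw [h, Set.pair_eq_singleton, Set.ncard_singleton] at h2
    exact absurd h2 (by norm_num)
  · intro hne
    exact Set.ncard_pair (Ne.symm hne)

/-- **«`v` is non-split in `K` ⟺ `c ∈ D(P/v)`»**: complex conjugation lies in the decomposition group (the
stabiliser) of `P` in `Gal(K/K⁺)` iff `v` has one prime of `K` above it. -/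
theorem complexConj_mem_stabilizer_iff_ncard_eq_one :
    complexConj K ∈ stabilizer (K ≃ₐ[maximalRealSubfield K] K) P ↔ (v.asIdeal.primesOver (𝓞 K)).ncard = 1 := by
  rw [mem_stabilizer_iff, ncard_primesOver_eq_one_iff_smul_eq K v P]

/-- **For an unramified `P` above `v`: `v` stays prime in `K` (`v 𝓞_K = P`) iff complex conjugation fixes `P`** (file
236's `map_eq_of_ramificationIdx'_eq_one_of_ncard_primesOver_eq_one` and file 233's
`ncard_primesOver_eq_one_of_staysPrime`). -/
theorem exists_map_eq_iff_smul_eq (he : P.ramificationIdx (𝓞 (maximalRealSubfield K)) = 1) :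
    (∃ w : HeightOneSpectrum (𝓞 K),
      Ideal.map (algebraMap (𝓞 (maximalRealSubfield K)) (𝓞 K)) v.asIdeal = w.asIdeal) ↔
      complexConj K • P = P := by
  rw [← ncard_primesOver_eq_one_iff_smul_eq K v P]
  constructor
  · rintro ⟨w, hw⟩
    haveI := liesOver_of_map_eq K v w hw
    exact ncard_primesOver_eq_one_of_staysPrime K v w hw
  · intro h1
    refine ⟨⟨P, hP, Ideal.ne_bot_of_liesOver_of_ne_bot v.ne_bot P⟩,
      map_eq_of_ramificationIdx'_eq_one_of_ncard_primesOver_eq_one K v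
        ⟨P, hP, Ideal.ne_bot_of_liesOver_of_ne_bot v.ne_bot P⟩ ?_ h1⟩
    rw [Ideal.ramificationIdx'_eq_ramificationIdx v.asIdeal P v.ne_bot]
    exact he

end CM

end Summit.Ventures.HodgeRepro2.T5CMFieldConjugationDecomposition
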